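import Mathlib
import Summits.NavierStokesRegularity.NavierStokesRegularity.Theorems.TaoLadderRungTwoBreakBlowupRigidityOneEnergyClimbing
import HarnessLib

/-!
# ACTION PROPAGATES ONE BOND AT A TIME: under the amplitude ceiling `‖x_k‖ ≤ Bν^k` the next shell is controlled by the
  PARTIAL ACTION of the shell below, `‖x_{k+1}(t)‖ ≤ C_A B ν^k · Λ^k∫₀ᵗ‖x_k‖`, and the partial actions obey the recursion
  `Λ^{k+1}∫₀ᵗ‖x_{k+1}‖ ≤ Λ C_A B (Λν)^k ∫₀ᵗ (Λ^k∫₀ˢ‖x_k‖) ds` — the kernel form of the census statement on the pre-firing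
  action bound (F2a') of the front bundle of `stub_eternalFromBlowup` (K2(1) `TaoLadderRungTwoBreak.BlowupRigidityOne`,
  stmt-NavierStokesRegularity-20206)

MODEL lattice ODEs only (Tao 2016 §4 (4.3), (4.8)–(4.10)); nothing here is a statement about the Navier–Stokes equations;
NO item is closed (`--supports stmt-NavierStokesRegularity-20206`). Route-independent; general `m`; DEF-FREE. Corollaries of
`norm_succ_le_action_sq` (p820487).

* `norm_succ_le_amp_mul_action` — one-shell datum exact flow, cancelling table, amplitude ceiling on shell `k`:
  `‖x_{k+1}(t)‖ ≤ C_A B ν^k (Λ^k ∫₀ᵗ ‖x_k‖)`;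
* `action_succ_le_integral_action` — `Λ^{k+1} ∫₀ᵗ ‖x_{k+1}‖ ≤ Λ C_A B (Λν)^k ∫₀ᵗ (Λ^k ∫₀ˢ ‖x_k‖) ds`. READING: a uniform
  pre-firing action bound (F2a') holds iff each partial action `a_k(s) = Λ^k∫₀ˢ‖x_k‖` rises from `≈ 0` to `O(1)` within a
  window of length `O((Λν)^{-k})` — a passage-time property of the front (open).

HONEST LABEL: a-priori bookkeeping; no stub, crux or summit is proved; rung 0.
-/

noncomputable section

-- the summit and its single sub-problem share the name (CONVENTIONS §1)
set_option linter.dupNamespace false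

open Set Filter Topology MeasureTheory intervalIntegral

namespace Summit.NavierStokesRegularity.NavierStokesRegularity.Theorems

namespace BlowupRigidityOne

open Literature.Analysis.FluidPDE Literature.Analysis.FluidPDE.TaoCascade

variable {m : ℕ}

/-- **The next shell is controlled by the partial action of the shell below** (energy climbing × amplitude ceiling).
[cite: Tao2016AveragedNS, §4 (4.3), Lemma 4.1 (4.8)–(4.10); §1.2] -/
theorem norm_succ_le_amp_mul_action {ε₀ T B ν : ℝ} (hε : 0 < ε₀)
    {α : Fin m → Fin m → Fin m → ℤ × ℤ × ℤ → ℝ} (hc : IsCancellingCoeff α)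
    {X : Fin m → ℤ → ℝ → ℝ} {X₀ : Fin m → ℝ}
    (hder : ∀ i k, ∀ t ∈ Ico 0 T, HasDerivWithinAt (X i k) (quadTerm ε₀ α X i k t) (Ici 0) t)
    (hinit : ∀ i k, X i k 0 = if k = 0 then X₀ i else 0)
    (hlow : ∀ i k t, k < 0 → X i k t = 0)
    (hreg : ∀ T' : ℝ, T' < T → ∃ M : ℝ, ∀ t ∈ Icc 0 T', ∀ (i : Fin m) (k : ℤ),
      (1 + (1 + ε₀) ^ ((10 : ℝ) * k)) * |X i k t| ≤ M)
    (k : ℕ) (hamp : ∀ t ∈ Ico (0 : ℝ) T, ‖shellVec X (k : ℤ) t‖ ≤ B * ν ^ k) :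
    ∀ t ∈ Ico 0 T, ‖shellVec X ((k : ℤ) + 1) t‖ ≤
      fluxConst α * B * ν ^ k * (bigLam ε₀ ^ k * ∫ s in (0 : ℝ)..t, ‖shellVec X (k : ℤ) s‖) := by
  intro t ht
  have hL : 0 < bigLam ε₀ := bigLam_pos (by linarith)
  have hCA : 0 ≤ fluxConst α := fluxConst_nonneg α
  have h1 := norm_succ_le_action_sq hε hc hder hinit hlow hreg k t ht
  -- continuity of `‖x_k‖` on `[0,t]`
  have hcx : ContinuousOn (fun s => shellVec X (k : ℤ) s) (Ico 0 T) := by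
    have hcp : ContinuousOn (fun s => fun i => X i (k : ℤ) s) (Ico 0 T) :=
      continuousOn_pi.2 fun i s hs => ((hder i k s hs).continuousWithinAt).mono fun x hx => hx.1
    exact (PiLp.continuous_toLp 2 (fun _ : Fin m => ℝ)).comp_continuousOn hcp
  have hsub : Icc 0 t ⊆ Ico 0 T := fun s hs => ⟨hs.1, lt_of_le_of_lt hs.2 ht.2⟩
  have hcn : ContinuousOn (fun s => ‖shellVec X (k : ℤ) s‖) (Icc 0 t) := (hcx.mono hsub).norm
  have hB : 0 ≤ B * ν ^ k := (norm_nonneg _).trans (hamp 0 ⟨le_rfl, lt_of_le_of_lt ht.1 ht.2⟩)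
  -- `∫‖x_k‖² ≤ Bν^k ∫‖x_k‖`
  have h2 : ∫ s in (0 : ℝ)..t, ‖shellVec X (k : ℤ) s‖ ^ 2 ≤ B * ν ^ k * ∫ s in (0 : ℝ)..t, ‖shellVec X (k : ℤ) s‖ := by
    rw [← intervalIntegral.integral_const_mul]
    refine intervalIntegral.integral_mono_on ht.1 ?_ ?_ fun s hs => ?_
    · exact ((hcn.pow 2).mono (by rw [uIcc_of_le ht.1])).intervalIntegrable
    · exact ((continuousOn_const.mul hcn).mono (by rw [uIcc_of_le ht.1])).intervalIntegrable
    · have hx := hamp s (hsub hs)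
      have hn := norm_nonneg (shellVec X (k : ℤ) s)
      nlinarith
  calc ‖shellVec X ((k : ℤ) + 1) t‖ ≤ fluxConst α * bigLam ε₀ ^ k * ∫ s in (0 : ℝ)..t, ‖shellVec X (k : ℤ) s‖ ^ 2 := h1
    _ ≤ fluxConst α * bigLam ε₀ ^ k * (B * ν ^ k * ∫ s in (0 : ℝ)..t, ‖shellVec X (k : ℤ) s‖) :=
        mul_le_mul_of_nonneg_left h2 (by positivity)
    _ = fluxConst α * B * ν ^ k * (bigLam ε₀ ^ k * ∫ s in (0 : ℝ)..t, ‖shellVec X (k : ℤ) s‖) := by ring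

/-- **THE ACTION RECURSION**: `Λ^{k+1}∫₀ᵗ‖x_{k+1}‖ ≤ Λ C_A B (Λν)^k ∫₀ᵗ (Λ^k∫₀ˢ‖x_k‖) ds`.
[cite: Tao2016AveragedNS, §4 (4.3), Lemma 4.1 (4.8)–(4.10); §1.2] -/
theorem action_succ_le_integral_action {ε₀ T B ν : ℝ} (hε : 0 < ε₀)
    {α : Fin m → Fin m → Fin m → ℤ × ℤ × ℤ → ℝ} (hc : IsCancellingCoeff α)
    {X : Fin m → ℤ → ℝ → ℝ} {X₀ : Fin m → ℝ}
    (hder : ∀ i k, ∀ t ∈ Ico 0 T, HasDerivWithinAt (X i k) (quadTerm ε₀ α X i k t) (Ici 0) t)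
    (hinit : ∀ i k, X i k 0 = if k = 0 then X₀ i else 0)
    (hlow : ∀ i k t, k < 0 → X i k t = 0)
    (hreg : ∀ T' : ℝ, T' < T → ∃ M : ℝ, ∀ t ∈ Icc 0 T', ∀ (i : Fin m) (k : ℤ),
      (1 + (1 + ε₀) ^ ((10 : ℝ) * k)) * |X i k t| ≤ M)
    (k : ℕ) (hamp : ∀ t ∈ Ico (0 : ℝ) T, ‖shellVec X (k : ℤ) t‖ ≤ B * ν ^ k) :
    ∀ t ∈ Ico 0 T, bigLam ε₀ ^ (k + 1) * ∫ s in (0 : ℝ)..t, ‖shellVec X ((k : ℤ) + 1) s‖ ≤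
      bigLam ε₀ * fluxConst α * B * (bigLam ε₀ * ν) ^ k *
        ∫ s in (0 : ℝ)..t, (bigLam ε₀ ^ k * ∫ r in (0 : ℝ)..s, ‖shellVec X (k : ℤ) r‖) := by
  intro t ht
  have hL : 0 < bigLam ε₀ := bigLam_pos (by linarith)
  have hCA : 0 ≤ fluxConst α := fluxConst_nonneg α
  have hB : 0 ≤ B * ν ^ k := (norm_nonneg _).trans (hamp 0 ⟨le_rfl, lt_of_le_of_lt ht.1 ht.2⟩)
  have hsub : Icc 0 t ⊆ Ico 0 T := fun s hs => ⟨hs.1, lt_of_le_of_lt hs.2 ht.2⟩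
  -- continuity of the shells and of the primitive
  have hcx : ∀ j : ℤ, ContinuousOn (fun s => shellVec X j s) (Ico 0 T) := by
    intro j
    have hcp : ContinuousOn (fun s => fun i => X i j s) (Ico 0 T) :=
      continuousOn_pi.2 fun i s hs => ((hder i j s hs).continuousWithinAt).mono fun x hx => hx.1
    exact (PiLp.continuous_toLp 2 (fun _ : Fin m => ℝ)).comp_continuousOn hcp
  have hcn1 : ContinuousOn (fun s => ‖shellVec X ((k : ℤ) + 1) s‖) (Icc 0 t) := ((hcx _).mono hsub).norm
  have hcnk : ContinuousOn (fun s => ‖shellVec X (k : ℤ) s‖) (Icc 0 t) := ((hcx _).mono hsub).norm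
  have hprim : ContinuousOn (fun s => bigLam ε₀ ^ k * ∫ r in (0 : ℝ)..s, ‖shellVec X (k : ℤ) r‖) (Icc 0 t) := by
    refine continuousOn_const.mul ?_
    have hio : IntegrableOn (fun r => ‖shellVec X (k : ℤ) r‖) (uIcc 0 t) := by
      rw [uIcc_of_le ht.1]; exact hcnk.integrableOn_Icc
    have h := intervalIntegral.continuousOn_primitive_interval (μ := volume) hio
    rwa [uIcc_of_le ht.1] at h
  -- pointwise bound, then integrate
  have hpt : ∀ s ∈ Icc (0 : ℝ) t, ‖shellVec X ((k : ℤ) + 1) s‖ ≤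
      fluxConst α * B * ν ^ k * (bigLam ε₀ ^ k * ∫ r in (0 : ℝ)..s, ‖shellVec X (k : ℤ) r‖) := fun s hs =>
    norm_succ_le_amp_mul_action hε hc hder hinit hlow hreg k hamp s (hsub hs)
  have hint : ∫ s in (0 : ℝ)..t, ‖shellVec X ((k : ℤ) + 1) s‖ ≤
      ∫ s in (0 : ℝ)..t, fluxConst α * B * ν ^ k * (bigLam ε₀ ^ k * ∫ r in (0 : ℝ)..s, ‖shellVec X (k : ℤ) r‖) := by
    refine intervalIntegral.integral_mono_on ht.1 ?_ ?_ hpt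
    · exact (hcn1.mono (by rw [uIcc_of_le ht.1])).intervalIntegrable
    · exact ((continuousOn_const.mul hprim).mono (by rw [uIcc_of_le ht.1])).intervalIntegrable
  rw [intervalIntegral.integral_const_mul] at hint
  have hpow : bigLam ε₀ ^ (k + 1) * (fluxConst α * B * ν ^ k) = bigLam ε₀ * fluxConst α * B * (bigLam ε₀ * ν) ^ k := by
    rw [pow_succ, mul_pow]; ring
  calc bigLam ε₀ ^ (k + 1) * ∫ s in (0 : ℝ)..t, ‖shellVec X ((k : ℤ) + 1) s‖
      ≤ bigLam ε₀ ^ (k + 1) * (fluxConst α * B * ν ^ k *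
          ∫ s in (0 : ℝ)..t, (bigLam ε₀ ^ k * ∫ r in (0 : ℝ)..s, ‖shellVec X (k : ℤ) r‖)) :=
        mul_le_mul_of_nonneg_left hint (pow_pos hL _).le
    _ = bigLam ε₀ * fluxConst α * B * (bigLam ε₀ * ν) ^ k *
          ∫ s in (0 : ℝ)..t, (bigLam ε₀ ^ k * ∫ r in (0 : ℝ)..s, ‖shellVec X (k : ℤ) r‖) := by
        rw [← mul_assoc, hpow]

end BlowupRigidityOne

end Summit.NavierStokesRegularity.NavierStokesRegularity.Theorems

end
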